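import Summits.QuantumAdvantage.AdviceFreeQNC0.WindowLocalization
import Summits.QuantumAdvantage.AdviceFreeQNC0.WalkCoreBasics
import Summits.QuantumAdvantage.AdviceFreeQNC0.EliminationHardness
import HarnessLib

/-!
# Cell qa-qnc0 (rung F-Q1, route RingFrame, crux α `RingToElim`): TWO BLIND SPOTS, part 1 — the
# one-sided fibre identity (planner qa-qnc0-p1's THEOREM-TARGET T8, Sketch11 §23.2)

Walk game in walk coordinates (`ringWinU`, charge `c`), input `u = a ++ z ++ b` (`glue3`) with the
block `z` of `M` bits at `[p, p + M)`, outside blocks `(a, b)` FIXED.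

* `interiorPar s y'` — THE INTERIOR TRIPLE `B_s(z)`: parity of the cuts strictly inside the block
  (`0 < g < M`) selected at `z` whose character with offset `s`, `s + g + |z| + W_g(z)`, is
  non-zero mod `3`; `3`-periodic (`interiorPar_congr_mod`) and EVEN in `s` (`interiorPar_even`:
  each interior cut is live for exactly two offsets); depends on the interior selectors only
  (`interiorPar_congr`).
* `ringWinU_eq_ends_xor_interior` — on the `M`-cube at charge `s`:
  `WIN(z) = [y_0(z) ∧ s + |z| ≢ 0] ⊕ [y_M(z) ∧ s + M + 2|z| ≢ 0] ⊕ B_s(z)`.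
* `outerTriple`, `outerTriple_isEvenTriple` — the outside triple `outParity` (window localisation,
  `WindowLocalization.lean`) ⊕ the two block ends is an EVEN triple `Q` of degree `≤ D`.
* `ringWinU_glue3_eq_outer_xor_interior` — **THE ONE-SIDED FIBRE IDENTITY**
  `WIN(a ++ z ++ b) = Q_{|z| mod 3}(z) ⊕ B_{c'}(z)`, `c' = inCharge c a b = c + p + 2|a| + |b|`,
  `B_s = interiorPar s (inStrategy y a b)`.
* `distFail_le_card_loss` — since `𝟙 ⊕ Q` is an elimination FAIL pattern of degree `≤ D`
  (`failCompl_iff_evenTriple`), the fibre LOSES on at least `distFail D (B_{c'})` block contents.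

Nothing is assumed about which bits the selectors read: the identity holds for every strategy.
Part 2 (`TwoBlindSpots.lean`) adds the two blind outside bits and the four-flip orbit.  The cell's
lemmas (planner qa-qnc0-p1 gen 11, prover qa-qnc0-prover gen 6, 2026-08-27); not in print.
WHAT THIS IS NOT: no hardness statement here; nothing on α; no separation.
-/

noncomputable section

namespace Summit.QuantumAdvantage.AdviceFreeQNC0

open Finset
open Literature.Computability.MetaComplexity Literature.Computability.MetaComplexity.Smolensky

/-! ### Small tools -/

/-- Parities add. [folklore] -/
private theorem decide_odd_add₂ (A B : ℕ) :
    decide ((A + B) % 2 = 1) = xor (decide (A % 2 = 1)) (decide (B % 2 = 1)) := by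
  rcases Nat.mod_two_eq_zero_or_one A with hA | hA <;>
    rcases Nat.mod_two_eq_zero_or_one B with hB | hB <;> simp [Nat.add_mod, hA, hB]

/-- Three pairwise distinct residues mod `3` contain exactly one zero. [folklore] -/
private theorem xor3_decide_mod3₂ (n0 n1 n2 : ℕ) (h01 : n0 % 3 ≠ n1 % 3) (h02 : n0 % 3 ≠ n2 % 3)
    (h12 : n1 % 3 ≠ n2 % 3) :
    xor (decide (n0 % 3 ≠ 0)) (xor (decide (n1 % 3 ≠ 0)) (decide (n2 % 3 ≠ 0))) = false := by
  cases h0 : decide (n0 % 3 ≠ 0) <;> cases h1 : decide (n1 % 3 ≠ 0) <;>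
    cases h2 : decide (n2 % 3 ≠ 0) <;>
    simp only [decide_eq_true_eq, decide_eq_false_iff_not, not_not] at h0 h1 h2 <;>
    first | rfl | omega

/-- Pointwise-even masks give an even triple of parities (cell lemma `xor3_parity_of_pointwise`,
`CrossFreeWindow.lean`, repeated to keep the imports light). -/
private theorem xor3_parity_of_pointwise₂ {ι : Type*} (S : Finset ι) (f e₀ e₁ e₂ : ι → Bool)
    (he : ∀ g, xor (e₀ g) (xor (e₁ g) (e₂ g)) = false) :
    xor (decide ((S.filter fun g => (f g && e₀ g) = true).card % 2 = 1))
      (xor (decide ((S.filter fun g => (f g && e₁ g) = true).card % 2 = 1))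
        (decide ((S.filter fun g => (f g && e₂ g) = true).card % 2 = 1))) = false := by
  classical
  have hcount : ∀ e : ι → Bool, (S.filter fun g => (f g && e g) = true).card =
      ∑ g ∈ S, (if (f g && e g) = true then 1 else 0) := fun e => by
    rw [Finset.card_filter]
  have hsum : ((S.filter fun g => (f g && e₀ g) = true).card
      + (S.filter fun g => (f g && e₁ g) = true).card
      + (S.filter fun g => (f g && e₂ g) = true).card) % 2 = 0 := by
    rw [hcount e₀, hcount e₁, hcount e₂, ← Finset.sum_add_distrib, ← Finset.sum_add_distrib]
    have hdvd : 2 ∣ ∑ g ∈ S, ((if (f g && e₀ g) = true then 1 else 0) +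
        (if (f g && e₁ g) = true then 1 else 0) + (if (f g && e₂ g) = true then 1 else 0)) := by
      refine Finset.dvd_sum fun g _ => ?_
      have := he g
      revert this
      cases f g <;> cases e₀ g <;> cases e₁ g <;> cases e₂ g <;> decide
    omega
  rw [← decide_odd_add₂, ← decide_odd_add₂, ← Nat.add_assoc, hsum]
  decide

/-- `W_0(z) = 0`. [folklore] -/
private theorem wtPrefix_zero₂ {n : ℕ} (u : Fin n → Bool) : wtPrefix u 0 = 0 := by
  unfold wtPrefix
  rw [Finset.card_eq_zero, Finset.filter_eq_empty_iff]
  intro i _ h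
  exact absurd h.1 (Nat.not_lt_zero _)

/-- `W_g(z) = |z|` for `g ≥ M`. [folklore] -/
private theorem wtPrefix_of_ge₂ {n : ℕ} (u : Fin n → Bool) {g : ℕ} (hg : n ≤ g) : wtPrefix u g = wt u := by
  unfold wtPrefix wt
  refine congrArg _ (Finset.filter_congr fun i _ => ?_)
  constructor
  · rintro ⟨-, h⟩; exact h
  · intro h; exact ⟨by omega, h⟩

/-- Masking by a constant keeps the degree (cell lemma `hasDeg_and_const'`, `ProductBlocks.lean`,
repeated to keep the imports light). -/
private theorem hasDeg_and_const₂ {k D : ℕ} {f : (Fin k → Bool) → Bool} (hf : HasDeg f D) (b : Bool) :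
    HasDeg (fun u => f u && b) D := by
  cases b
  · have : (fun u => f u && false) = fun _ : Fin k → Bool => false := by funext u; simp
    rw [this]; exact hasDeg_false D
  · have : (fun u => f u && true) = f := by funext u; simp
    rw [this]; exact hf

variable {M : ℕ}

/-! ### The interior triple of a walk strategy on the `M`-cube -/

/-- **The interior triple** `B_s(z)`: parity of the cuts strictly inside the block (`0 < g < M`)
that are selected at `z` and whose character with OFFSET `s` — `s + g + |z| + W_g(z)` — is non-zero
mod `3`.  For a walk strategy at charge `c'` the interior contributes `B_{c'}`. -/
def interiorPar (s : ℕ) (y' : Fin (M + 1) → (Fin M → Bool) → Bool) (z : Fin M → Bool) : Bool :=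
  decide ((((univ : Finset (Fin (M + 1))).filter fun g => 0 < g.val ∧ g.val < M).filter fun g =>
    (y' g z && decide ((s + g.val + wt z + wtPrefix z g.val) % 3 ≠ 0)) = true).card % 2 = 1)

/-- The interior triple depends on the offset only mod `3`. -/
theorem interiorPar_congr_mod {s s' : ℕ} (h : s % 3 = s' % 3)
    (y' : Fin (M + 1) → (Fin M → Bool) → Bool) : interiorPar s y' = interiorPar s' y' := by
  funext z
  unfold interiorPar
  have hS : (((univ : Finset (Fin (M + 1))).filter fun g => 0 < g.val ∧ g.val < M).filter fun g =>
      (y' g z && decide ((s + g.val + wt z + wtPrefix z g.val) % 3 ≠ 0)) = true) =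
      (((univ : Finset (Fin (M + 1))).filter fun g => 0 < g.val ∧ g.val < M).filter fun g =>
      (y' g z && decide ((s' + g.val + wt z + wtPrefix z g.val) % 3 ≠ 0)) = true) := by
    refine Finset.filter_congr fun g _ => ?_
    have : (s + g.val + wt z + wtPrefix z g.val) % 3 = (s' + g.val + wt z + wtPrefix z g.val) % 3 := by
      omega
    rw [this]
  rw [hS]

/-- **The interior triple is EVEN**: `B_s ⊕ B_{s+1} ⊕ B_{s+2} ≡ 0` (each interior cut is live for
exactly two of the three offsets). -/
theorem interiorPar_even (s : ℕ) (y' : Fin (M + 1) → (Fin M → Bool) → Bool) (z : Fin M → Bool) :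
    xor (interiorPar s y' z) (xor (interiorPar (s + 1) y' z) (interiorPar (s + 2) y' z)) = false := by
  unfold interiorPar
  exact xor3_parity_of_pointwise₂ _ (fun g => y' g z)
    (fun g => decide ((s + g.val + wt z + wtPrefix z g.val) % 3 ≠ 0))
    (fun g => decide ((s + 1 + g.val + wt z + wtPrefix z g.val) % 3 ≠ 0))
    (fun g => decide ((s + 2 + g.val + wt z + wtPrefix z g.val) % 3 ≠ 0))
    fun g => xor3_decide_mod3₂ _ _ _ (by omega) (by omega) (by omega)

/-- The interior triple only depends on the interior selectors. -/
theorem interiorPar_congr {y₁ y₂ : Fin (M + 1) → (Fin M → Bool) → Bool}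
    (h : ∀ g : Fin (M + 1), 0 < g.val → g.val < M → y₁ g = y₂ g) (s : ℕ) :
    interiorPar s y₁ = interiorPar s y₂ := by
  funext z
  unfold interiorPar
  have hS : (((univ : Finset (Fin (M + 1))).filter fun g => 0 < g.val ∧ g.val < M).filter fun g =>
      (y₁ g z && decide ((s + g.val + wt z + wtPrefix z g.val) % 3 ≠ 0)) = true) =
      (((univ : Finset (Fin (M + 1))).filter fun g => 0 < g.val ∧ g.val < M).filter fun g =>
      (y₂ g z && decide ((s + g.val + wt z + wtPrefix z g.val) % 3 ≠ 0)) = true) := by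
    refine Finset.filter_congr fun g hg => ?_
    rw [Finset.mem_filter] at hg
    rw [h g hg.2.1 hg.2.2]
  rw [hS]

/-- The parity bit of a filter of a singleton. -/
private theorem decide_card_filter_singleton₂ {α : Type*} [DecidableEq α] (a : α) (P : α → Prop)
    [DecidablePred P] :
    decide ((({a} : Finset α).filter P).card % 2 = 1) = decide (P a) := by
  rw [Finset.filter_singleton]
  by_cases h : P a <;> simp [h]

/-- **Ends / interior split of the walk win bit** on the `M`-cube (`0 < M`): at charge `s`,
`WIN(z) = [y_0(z) ∧ s + |z| ≢ 0] ⊕ [y_M(z) ∧ s + M + 2|z| ≢ 0] ⊕ B_s(z)`. -/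
theorem ringWinU_eq_ends_xor_interior (hM : 0 < M) (s : ℕ)
    (y' : Fin (M + 1) → (Fin M → Bool) → Bool) (z : Fin M → Bool) :
    ringWinU s y' z =
      xor (xor (y' 0 z && decide ((s + wt z) % 3 ≠ 0))
            (y' (Fin.last M) z && decide ((s + M + 2 * wt z) % 3 ≠ 0)))
        (interiorPar s y' z) := by
  classical
  set S := univ.filter fun g : Fin (M + 1) =>
    y' g z = true ∧ (s + g.val + walkExp z g.val) % 3 ≠ 0 with hS
  have hsplit : S.card = (S.filter fun g => g.val = 0).card
      + (S.filter fun g => g.val = M).card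
      + (S.filter fun g => 0 < g.val ∧ g.val < M).card := by
    have h1 : ∀ g ∈ S, (1 : ℕ) = (if g.val = 0 then 1 else 0) + (if g.val = M then 1 else 0)
        + (if 0 < g.val ∧ g.val < M then 1 else 0) := by
      intro g _
      have := g.isLt
      split_ifs <;> omega
    rw [Finset.card_eq_sum_ones, Finset.sum_congr rfl h1, Finset.sum_add_distrib,
      Finset.sum_add_distrib]
    simp only [Finset.card_filter]
  -- `g = 0`
  have h0 : decide ((S.filter fun g => g.val = 0).card % 2 = 1) =
      (y' 0 z && decide ((s + wt z) % 3 ≠ 0)) := by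
    have hset : (S.filter fun g => g.val = 0) = ({(0 : Fin (M + 1))} : Finset _).filter
        fun g => y' g z = true ∧ (s + g.val + walkExp z g.val) % 3 ≠ 0 := by
      ext g
      simp only [hS, Finset.mem_filter, Finset.mem_univ, true_and, Finset.mem_singleton]
      constructor
      · rintro ⟨h1, h2⟩; exact ⟨Fin.ext h2, h1⟩
      · rintro ⟨h1, h2⟩; exact ⟨h2, by rw [h1]; rfl⟩
    rw [hset, decide_card_filter_singleton₂]
    have hchar : (s + (0 : Fin (M + 1)).val + walkExp z (0 : Fin (M + 1)).val) % 3 =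
        (s + wt z) % 3 := by
      simp only [Fin.val_zero, walkExp, wtPrefix_zero₂, add_zero]
    rw [hchar]
    cases y' 0 z <;> simp
  -- `g = M`
  have hE : decide ((S.filter fun g => g.val = M).card % 2 = 1) =
      (y' (Fin.last M) z && decide ((s + M + 2 * wt z) % 3 ≠ 0)) := by
    have hset : (S.filter fun g => g.val = M) = (({Fin.last M} : Finset _).filter
        fun g => y' g z = true ∧ (s + g.val + walkExp z g.val) % 3 ≠ 0) := by
      ext g
      simp only [hS, Finset.mem_filter, Finset.mem_univ, true_and, Finset.mem_singleton]
      constructor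
      · rintro ⟨h1, h2⟩; exact ⟨Fin.ext (by simp [h2]), h1⟩
      · rintro ⟨h1, h2⟩; exact ⟨h2, by rw [h1]; simp⟩
    rw [hset, decide_card_filter_singleton₂]
    have hchar : (s + (Fin.last M).val + walkExp z (Fin.last M).val) % 3 =
        (s + M + 2 * wt z) % 3 := by
      simp only [Fin.val_last, walkExp, wtPrefix_of_ge₂ z le_rfl]
      omega
    rw [hchar]
    cases y' (Fin.last M) z <;> simp
  -- interior
  have hI : (S.filter fun g => 0 < g.val ∧ g.val < M) =
      ((univ : Finset (Fin (M + 1))).filter fun g => 0 < g.val ∧ g.val < M).filter fun g =>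
        (y' g z && decide ((s + g.val + wt z + wtPrefix z g.val) % 3 ≠ 0)) = true := by
    rw [hS, Finset.filter_filter, Finset.filter_filter]
    refine Finset.filter_congr fun g _ => ?_
    have hpre : (s + g.val + walkExp z g.val) % 3 = (s + g.val + wt z + wtPrefix z g.val) % 3 := by
      unfold walkExp; omega
    constructor
    · rintro ⟨⟨h1, h2⟩, h3⟩
      refine ⟨h3, ?_⟩
      rw [h1, ← hpre]
      simp [h2]
    · rintro ⟨h3, h5⟩
      refine ⟨⟨?_, ?_⟩, h3⟩
      · revert h5; cases y' g z <;> simp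
      · rw [hpre]; revert h5; cases y' g z <;> simp
  unfold ringWinU interiorPar
  rw [← hS, hsplit, decide_odd_add₂, decide_odd_add₂, h0, hE, hI]

variable {p q : ℕ}

/-! ### The one-sided fibre identity on `a ++ z ++ b` -/

/-- **The outer triple** `Q_r(z)` of the fibre `(a, b)`: the outside triple `P_r` (`outParity`) ⊕
the left block end (`g = p`, character `c' + r`) ⊕ the right block end (`g = p + M`, character
`c' + M + 2r`), `c' = inCharge c a b`; read at `r = |z| mod 3`. -/
def outerTriple (c : ℕ) (y : Fin (p + M + q + 1) → (Fin (p + M + q) → Bool) → Bool)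
    (a : Fin p → Bool) (b : Fin q → Bool) (r : ℕ) (z : Fin M → Bool) : Bool :=
  xor (outParity y c a b r z)
    (xor (inStrategy y a b 0 z && decide ((inCharge c a b + r) % 3 ≠ 0))
      (inStrategy y a b (Fin.last M) z && decide ((inCharge c a b + M + 2 * r) % 3 ≠ 0)))

variable (c : ℕ) (y : Fin (p + M + q + 1) → (Fin (p + M + q) → Bool) → Bool)

/-- **The outer triple is an even triple of degree `≤ D`.** -/
theorem outerTriple_isEvenTriple {D : ℕ} (hdeg : ∀ g, HasDeg (y g) D) (a : Fin p → Bool)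
    (b : Fin q → Bool) : IsEvenTriple D (outerTriple c y a b) := by
  refine ⟨fun r => ?_, fun z => ?_⟩
  · unfold outerTriple
    exact hasDeg_xor (hasDeg_outParity c y hdeg a b r)
      (hasDeg_xor (hasDeg_and_const₂ (hasDeg_inStrategy y hdeg a b 0) _)
        (hasDeg_and_const₂ (hasDeg_inStrategy y hdeg a b (Fin.last M)) _))
  · have hP := outParity_even c y a b z
    have h0 : xor (decide ((inCharge c a b + 0) % 3 ≠ 0))
        (xor (decide ((inCharge c a b + 1) % 3 ≠ 0)) (decide ((inCharge c a b + 2) % 3 ≠ 0))) = false :=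
      xor3_decide_mod3₂ _ _ _ (by omega) (by omega) (by omega)
    have hM' : xor (decide ((inCharge c a b + M + 2 * 0) % 3 ≠ 0))
        (xor (decide ((inCharge c a b + M + 2 * 1) % 3 ≠ 0))
          (decide ((inCharge c a b + M + 2 * 2) % 3 ≠ 0))) = false :=
      xor3_decide_mod3₂ _ _ _ (by omega) (by omega) (by omega)
    unfold outerTriple
    revert hP h0 hM'
    generalize outParity y c a b 0 z = P0
    generalize outParity y c a b 1 z = P1
    generalize outParity y c a b 2 z = P2
    generalize decide ((inCharge c a b + 0) % 3 ≠ 0) = d0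
    generalize decide ((inCharge c a b + 1) % 3 ≠ 0) = d1
    generalize decide ((inCharge c a b + 2) % 3 ≠ 0) = d2
    generalize decide ((inCharge c a b + M + 2 * 0) % 3 ≠ 0) = f0
    generalize decide ((inCharge c a b + M + 2 * 1) % 3 ≠ 0) = f1
    generalize decide ((inCharge c a b + M + 2 * 2) % 3 ≠ 0) = f2
    generalize inStrategy y a b 0 z = s0
    generalize inStrategy y a b (Fin.last M) z = sM
    cases P0 <;> cases P1 <;> cases P2 <;> cases d0 <;> cases d1 <;> cases d2 <;> cases f0 <;>
      cases f1 <;> cases f2 <;> cases s0 <;> cases sM <;> decide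

/-- **THE ONE-SIDED FIBRE IDENTITY.**  On `a ++ z ++ b` (`0 < M`):
`WIN = Q_{|z| mod 3}(z) ⊕ B_{c'}(z)` with `Q = outerTriple c y a b` and
`B_s = interiorPar s (inStrategy y a b)`, `c' = inCharge c a b`. -/
theorem ringWinU_glue3_eq_outer_xor_interior (hM : 0 < M) (a : Fin p → Bool) (z : Fin M → Bool)
    (b : Fin q → Bool) :
    ringWinU c y (glue3 a z b) =
      xor (outerTriple c y a b (wt z % 3) z)
        (interiorPar (inCharge c a b) (inStrategy y a b) z) := by
  rw [ringWinU_glue3_eq_mixedWinU]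
  unfold mixedWinU outerTriple
  rw [ringWinU_eq_ends_xor_interior hM]
  have h1 : (inCharge c a b + wt z % 3) % 3 = (inCharge c a b + wt z) % 3 := by omega
  have h2 : (inCharge c a b + M + 2 * (wt z % 3)) % 3 = (inCharge c a b + M + 2 * wt z) % 3 := by omega
  rw [h1, h2]
  generalize outParity y c a b (wt z % 3) z = P
  generalize (inStrategy y a b 0 z && decide ((inCharge c a b + wt z) % 3 ≠ 0)) = e0
  generalize (inStrategy y a b (Fin.last M) z && decide ((inCharge c a b + M + 2 * wt z) % 3 ≠ 0)) = eM
  generalize interiorPar (inCharge c a b) (inStrategy y a b) z = B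
  cases P <;> cases e0 <;> cases eM <;> cases B <;> rfl

/-- **The fibre loses at least the potential cost of its interior triple**: with `(a, b)` fixed
and all selectors of degree `≤ D`, `#{z : ¬WIN(a ++ z ++ b)} ≥ distFail D (B_{c'})` — the
complement `𝟙 ⊕ Q` of the even outer triple is an elimination FAIL pattern of degree `≤ D`
(`failCompl_iff_evenTriple`), and the fibre loses exactly where `B_{c'}` differs from it. -/
theorem distFail_le_card_loss (hM : 0 < M) {D : ℕ} (hdeg : ∀ g, HasDeg (y g) D) (a : Fin p → Bool)
    (b : Fin q → Bool) :
    distFail D (interiorPar (inCharge c a b) (inStrategy y a b)) ≤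
      (univ.filter fun z : Fin M → Bool => ringWinU c y (glue3 a z b) = false).card := by
  have hF : IsElimFail D (fun z : Fin M → Bool => !(outerTriple c y a b (wt z % 3) z)) :=
    (failCompl_iff_evenTriple M D _).2 ⟨outerTriple c y a b, outerTriple_isEvenTriple c y hdeg a b,
      fun _ => rfl⟩
  refine le_trans (distFail_le _ hF) (le_of_eq ?_)
  unfold hdist
  refine congrArg Finset.card (Finset.filter_congr fun z _ => ?_)
  show interiorPar (inCharge c a b) (inStrategy y a b) z ≠ !(outerTriple c y a b (wt z % 3) z) ↔
    ringWinU c y (glue3 a z b) = false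
  rw [ringWinU_glue3_eq_outer_xor_interior c y hM a z b]
  generalize outerTriple c y a b (wt z % 3) z = Q
  generalize interiorPar (inCharge c a b) (inStrategy y a b) z = B
  cases Q <;> cases B <;> decide

end Summit.QuantumAdvantage.AdviceFreeQNC0

end
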